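import Summits.RiemannHypothesis.RiemannHypothesis.Theorems.SignConeConeMagnificationDesignClasses
import Literature.NumberTheory.LFunctions.RosserSchoenfeldMertensFirstConstantCorollaries

/-!
# Crux `SignCone.ConeMagnification` (stmt-RiemannHypothesis-16303), line `Sketch` r8:
# bookkeeping for the type inequalities — complex designs reduce to real ones, and the
# partial sums converge from Mertens + Loc alone

The type-inequality stub `stub_combType` of the skeleton asks, for every finitely supported complex design
`α : ℕ → ℂ`, that the partial sums `Σ_{n ≤ x} (d(n)/n) Re Φ_α(n)` (`d = c − Λ`,
`Φ_α(n) = Σ_{ℓ,ℓ' ≤ L} α_ℓ conj(α_ℓ') gcd(nℓ',ℓ)/√(ℓℓ')`) CONVERGE to a limit `T` with `T ≤ ½ Re Φ_α(1)`.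
This file removes two thirds of that burden from the comb evaluation:

* `re_gcdForm_eq_re_add_re`, `typeIneq_of_real` — the gcd kernel is real, so
  `Re Φ_α(n) = Re Φ_{Re α}(n) + Re Φ_{Im α}(n)`; hence the type inequalities for REAL designs imply them for
  all complex designs (limits and bounds add);
* `natCast_gcd_mul_eq_sum_totient` — `gcd(nℓ',ℓ) = Σ_{d ∣ ℓ, d/gcd(d,ℓ') ∣ n} φ(d)`;
* `tendsto_classSum` — the class sums `Σ_{n ≤ x, e ∣ n} d(n)/n` converge for every `e ≥ 1`: for `e = 1` by
  Mertens for `c` (hypothesis `hM`, output of `stub_fakeMertens`) and Mertens for `Λ`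
  (`tendsto_sum_vonMangoldt_div_sub_log`, in the tree); for `e ≥ 2` absolutely, by Loc;
* `tendsto_typeSum` — CONVERGENCE of the type partial sums for every design, from `hM` + Loc only;
* `typeIneq_iff_limit_le` — given that, the type inequality for `α` is just `T ≤ ½ Re Φ_α(1)` for THE limit `T`.

So `stub_combType` only has to bound the limit, and only for real designs.
-/

noncomputable section

-- `Summit.RiemannHypothesis.RiemannHypothesis.…` repeats a namespace component by design (D-0017 layout).
set_option linter.dupNamespace false

open Finset Filter
open scoped BigOperators ComplexConjugate Topology

namespace Summit.RiemannHypothesis.RiemannHypothesis.Theorems.SignConeConeMagnification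

namespace TypeIneq

open Summit.RiemannHypothesis.RiemannHypothesis.Theorems.SignConeConeMagnification.Design
  (tendsto_sum_Icc_floor_of_summable summable_dvd_abs_dwt_div)

/-! ### 1. Complex designs reduce to real designs -/

/-- Real part of one term of the gcd form: `Re(a conj(b) g / s) = (Re a Re b + Im a Im b) g / s` for real
`g, s`. [folklore] -/
theorem re_term (a b : ℂ) (g s : ℝ) :
    (a * (starRingEnd ℂ) b * (g : ℂ) / (s : ℂ)).re = (a.re * b.re + a.im * b.im) * g / s := by
  rw [Complex.div_ofReal_re]
  congr 1
  simp [Complex.mul_re, Complex.conj_re, Complex.conj_im]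

/-- **The gcd kernel is real**: `Re Φ_α(n) = Re Φ_{Re α}(n) + Re Φ_{Im α}(n)`. [folklore] -/
theorem re_gcdForm_eq_re_add_re (α : ℕ → ℂ) (L n : ℕ) :
    (∑ ℓ ∈ Finset.Icc 1 L, ∑ ℓ' ∈ Finset.Icc 1 L, α ℓ * (starRingEnd ℂ) (α ℓ') *
        (((Nat.gcd (n * ℓ') ℓ : ℕ) : ℝ) : ℂ) / (Real.sqrt ((ℓ : ℝ) * ℓ') : ℂ)).re =
      (∑ ℓ ∈ Finset.Icc 1 L, ∑ ℓ' ∈ Finset.Icc 1 L, (((α ℓ).re : ℝ) : ℂ) * (starRingEnd ℂ) (((α ℓ').re : ℝ) : ℂ) *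
        (((Nat.gcd (n * ℓ') ℓ : ℕ) : ℝ) : ℂ) / (Real.sqrt ((ℓ : ℝ) * ℓ') : ℂ)).re +
      (∑ ℓ ∈ Finset.Icc 1 L, ∑ ℓ' ∈ Finset.Icc 1 L, (((α ℓ).im : ℝ) : ℂ) * (starRingEnd ℂ) (((α ℓ').im : ℝ) : ℂ) *
        (((Nat.gcd (n * ℓ') ℓ : ℕ) : ℝ) : ℂ) / (Real.sqrt ((ℓ : ℝ) * ℓ') : ℂ)).re := by
  simp only [Complex.re_sum, re_term, Complex.ofReal_re, Complex.ofReal_im, mul_zero, add_zero,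
    ← Finset.sum_add_distrib]
  refine Finset.sum_congr rfl fun ℓ _ => Finset.sum_congr rfl fun ℓ' _ => ?_
  ring

/-- **Type inequalities: real designs suffice.**  If the type inequality (convergence of the partial sums of
`(d(n)/n) Re Φ_β(n)` to a limit `≤ ½ Re Φ_β(1)`) holds for every finitely supported REAL design `β`, it holds
for every finitely supported complex design `α` (apply it to `Re α` and `Im α` and add). [folklore] -/
theorem typeIneq_of_real (c : ℕ → ℝ)
    (hreal : ∀ β : ℕ → ℝ, ∀ L : ℕ, (∀ m, L < m → β m = 0) →
      ∃ T : ℝ, Tendsto (fun x : ℝ => ∑ n ∈ Finset.Icc 1 ⌊x⌋₊,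
          (c n - ArithmeticFunction.vonMangoldt n) / n *
            (∑ ℓ ∈ Finset.Icc 1 L, ∑ ℓ' ∈ Finset.Icc 1 L, ((β ℓ : ℝ) : ℂ) * (starRingEnd ℂ) ((β ℓ' : ℝ) : ℂ) *
            (((Nat.gcd (n * ℓ') ℓ : ℕ) : ℝ) : ℂ) / (Real.sqrt ((ℓ : ℝ) * ℓ') : ℂ)).re) atTop (𝓝 T) ∧
        T ≤ 1 / 2 * (∑ ℓ ∈ Finset.Icc 1 L, ∑ ℓ' ∈ Finset.Icc 1 L, ((β ℓ : ℝ) : ℂ) * (starRingEnd ℂ) ((β ℓ' : ℝ) : ℂ) *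
            (((Nat.gcd (1 * ℓ') ℓ : ℕ) : ℝ) : ℂ) / (Real.sqrt ((ℓ : ℝ) * ℓ') : ℂ)).re) :
    ∀ α : ℕ → ℂ, ∀ L : ℕ, (∀ m, L < m → α m = 0) →
      ∃ T : ℝ, Tendsto (fun x : ℝ => ∑ n ∈ Finset.Icc 1 ⌊x⌋₊,
          (c n - ArithmeticFunction.vonMangoldt n) / n *
            (∑ ℓ ∈ Finset.Icc 1 L, ∑ ℓ' ∈ Finset.Icc 1 L, α ℓ * (starRingEnd ℂ) (α ℓ') *
            (((Nat.gcd (n * ℓ') ℓ : ℕ) : ℝ) : ℂ) / (Real.sqrt ((ℓ : ℝ) * ℓ') : ℂ)).re) atTop (𝓝 T) ∧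
        T ≤ 1 / 2 * (∑ ℓ ∈ Finset.Icc 1 L, ∑ ℓ' ∈ Finset.Icc 1 L, α ℓ * (starRingEnd ℂ) (α ℓ') *
            (((Nat.gcd (1 * ℓ') ℓ : ℕ) : ℝ) : ℂ) / (Real.sqrt ((ℓ : ℝ) * ℓ') : ℂ)).re := by
  intro α L hα
  obtain ⟨T₁, h₁, b₁⟩ := hreal (fun m => (α m).re) L (fun m hm => by simp [hα m hm])
  obtain ⟨T₂, h₂, b₂⟩ := hreal (fun m => (α m).im) L (fun m hm => by simp [hα m hm])
  refine ⟨T₁ + T₂, ?_, ?_⟩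
  · refine (h₁.add h₂).congr fun x => ?_
    rw [← Finset.sum_add_distrib]
    refine Finset.sum_congr rfl fun n _ => ?_
    rw [re_gcdForm_eq_re_add_re α L n, mul_add]
  · rw [re_gcdForm_eq_re_add_re α L 1, mul_add]
    exact add_le_add b₁ b₂

/-! ### 2. The gcd kernel as a sum over divisor classes -/

/-- `d ∣ n·m ↔ d/gcd(d,m) ∣ n` (`d ≠ 0`). [folklore] -/
theorem dvd_mul_iff_div_gcd_dvd {d m n : ℕ} (hd : d ≠ 0) : d ∣ n * m ↔ d / Nat.gcd d m ∣ n := by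
  set g := Nat.gcd d m with hg
  have hg0 : 0 < g := Nat.gcd_pos_of_pos_left _ (Nat.pos_of_ne_zero hd)
  obtain ⟨d', hd'⟩ : g ∣ d := Nat.gcd_dvd_left d m
  obtain ⟨m', hm'⟩ : g ∣ m := Nat.gcd_dvd_right d m
  have hcop : Nat.Coprime d' m' := by
    have h := Nat.coprime_div_gcd_div_gcd (m := d) (n := m) hg0
    rw [← hg] at h
    have e1 : d / g = d' := by rw [hd', Nat.mul_div_cancel_left _ hg0]
    have e2 : m / g = m' := by rw [hm', Nat.mul_div_cancel_left _ hg0]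
    rwa [e1, e2] at h
  have e1 : d / g = d' := by rw [hd', Nat.mul_div_cancel_left _ hg0]
  rw [e1]
  constructor
  · intro h
    rw [hd', hm'] at h
    have h' : d' ∣ n * m' := by
      have : g * d' ∣ g * (n * m') := by
        have e : n * (g * m') = g * (n * m') := by ring
        rwa [e] at h
      exact (Nat.mul_dvd_mul_iff_left hg0).1 this
    exact hcop.dvd_of_dvd_mul_right h'
  · intro h
    rw [hd']
    calc g * d' ∣ g * n := Nat.mul_dvd_mul_left g h
      _ ∣ n * m := by
        rw [hm']
        exact ⟨m', by ring⟩

/-- **`gcd(nℓ',ℓ) = Σ_{d ∣ ℓ, d/gcd(d,ℓ') ∣ n} φ(d)`** (`ℓ ≠ 0`): Gauss' `Σ_{d ∣ m} φ(d) = m` at `m = gcd(nℓ',ℓ)`,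
whose divisors are the divisors `d` of `ℓ` with `d ∣ nℓ'`. [folklore] -/
theorem natCast_gcd_mul_eq_sum_totient (n ℓ ℓ' : ℕ) (hℓ : ℓ ≠ 0) :
    ((Nat.gcd (n * ℓ') ℓ : ℕ) : ℝ) =
      ∑ d ∈ ℓ.divisors, if d / Nat.gcd d ℓ' ∣ n then (Nat.totient d : ℝ) else 0 := by
  have hg0 : Nat.gcd (n * ℓ') ℓ ≠ 0 := Nat.gcd_ne_zero_right hℓ
  have h1 : (Nat.gcd (n * ℓ') ℓ : ℕ) = ∑ d ∈ (Nat.gcd (n * ℓ') ℓ).divisors, Nat.totient d :=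
    (Nat.sum_totient _).symm
  have h2 : (Nat.gcd (n * ℓ') ℓ).divisors = ℓ.divisors.filter (fun d => d ∣ n * ℓ') := by
    ext d
    simp only [Nat.mem_divisors, Finset.mem_filter, Nat.dvd_gcd_iff]
    constructor
    · rintro ⟨⟨h1, h2⟩, _⟩
      exact ⟨⟨h2, hℓ⟩, h1⟩
    · rintro ⟨⟨h1, _⟩, h2⟩
      exact ⟨⟨h2, h1⟩, hg0⟩
  rw [h1, h2, Finset.sum_filter]
  push_cast
  refine Finset.sum_congr rfl fun d hd => ?_
  have hd0 : d ≠ 0 := Nat.ne_of_gt (Nat.pos_of_mem_divisors hd)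
  by_cases h : d ∣ n * ℓ'
  · rw [if_pos h, if_pos ((dvd_mul_iff_div_gcd_dvd hd0).1 h)]
  · rw [if_neg h, if_neg (fun h' => h ((dvd_mul_iff_div_gcd_dvd hd0).2 h'))]

/-! ### 3. Class sums converge: Mertens (`e = 1`) and Loc (`e ≥ 2`) -/

/-- **The `e = 1` class**: `Σ_{n ≤ x} (c(n) − Λ(n))/n` converges, by Mertens for `c` (hypothesis) and Mertens for
`Λ` (`Σ_{n ≤ x} Λ(n)/n − log x → −γ`, in the tree). [folklore] -/
theorem tendsto_dwtSum (c : ℕ → ℝ)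
    (hM : ∃ C : ℝ, Tendsto (fun x : ℝ => (∑ n ∈ Finset.Icc 1 ⌊x⌋₊, c n / n) - Real.log x) atTop (𝓝 C)) :
    ∃ S : ℝ, Tendsto (fun x : ℝ => ∑ n ∈ Finset.Icc 1 ⌊x⌋₊,
      (c n - ArithmeticFunction.vonMangoldt n) / n) atTop (𝓝 S) := by
  obtain ⟨C, hC⟩ := hM
  have hΛ := Literature.NumberTheory.LFunctions.tendsto_sum_vonMangoldt_div_sub_log
  refine ⟨C - (-Real.eulerMascheroniConstant), (hC.sub hΛ).congr fun x => ?_⟩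
  have hI : Finset.Icc 1 ⌊x⌋₊ = Finset.Ioc 0 ⌊x⌋₊ := by
    ext n
    simp only [Finset.mem_Icc, Finset.mem_Ioc]
    omega
  rw [← hI, sub_sub_sub_cancel_right, ← Finset.sum_sub_distrib]
  exact Finset.sum_congr rfl fun n _ => by rw [sub_div]

/-- **The classes `e ≥ 2`**: `𝟙_{e ∣ n} (c(n) − Λ(n))/n` is absolutely summable (Loc at a prime `q ∣ e`). [folklore] -/
theorem summable_class_of_two_le (c : ℕ → ℝ) (hc0 : ∀ n, 0 ≤ c n)
    (hLoc : ∀ p : ℕ, p.Prime → Summable (fun n : ℕ => if p ∣ n then c n / n else 0)) {e : ℕ} (he : 2 ≤ e) :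
    Summable (fun n : ℕ => if e ∣ n then (c n - ArithmeticFunction.vonMangoldt n) / n else 0) := by
  obtain ⟨q, hq, hqe⟩ := Nat.exists_prime_and_dvd (show e ≠ 1 by omega)
  have hg := summable_dvd_abs_dwt_div c hc0 hLoc q hq
  refine hg.of_norm_bounded (fun n => ?_)
  by_cases h1 : e ∣ n
  · rw [if_pos h1, if_pos (dvd_trans hqe h1), Real.norm_eq_abs, abs_div, Nat.abs_cast]
  · rw [if_neg h1, norm_zero]
    split_ifs
    · positivity
    · exact le_rfl

/-- **Every class sum converges** (`e ≠ 0`): `Σ_{n ≤ x, e ∣ n} (c(n) − Λ(n))/n → S_e`. [folklore] -/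
theorem tendsto_classSum (c : ℕ → ℝ) (hc0 : ∀ n, 0 ≤ c n)
    (hM : ∃ C : ℝ, Tendsto (fun x : ℝ => (∑ n ∈ Finset.Icc 1 ⌊x⌋₊, c n / n) - Real.log x) atTop (𝓝 C))
    (hLoc : ∀ p : ℕ, p.Prime → Summable (fun n : ℕ => if p ∣ n then c n / n else 0)) (e : ℕ) (he : e ≠ 0) :
    ∃ S : ℝ, Tendsto (fun x : ℝ => ∑ n ∈ Finset.Icc 1 ⌊x⌋₊,
      (if e ∣ n then (c n - ArithmeticFunction.vonMangoldt n) / n else 0)) atTop (𝓝 S) := by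
  rcases Nat.lt_or_ge e 2 with h | h
  · -- `e = 1`
    have he1 : e = 1 := by omega
    subst he1
    obtain ⟨S, hS⟩ := tendsto_dwtSum c hM
    exact ⟨S, hS.congr fun x => Finset.sum_congr rfl fun n _ => by rw [if_pos (one_dvd n)]⟩
  · exact ⟨_, tendsto_sum_Icc_floor_of_summable _ (by simp) (summable_class_of_two_le c hc0 hLoc h)⟩

/-! ### 4. Convergence of the type partial sums for every design -/

/-- The real part of the gcd form, expanded over divisor classes:
`Re Φ_α(n) = Σ_{ℓ,ℓ'} Σ_{d ∣ ℓ} W(ℓ,ℓ',d) · [d/gcd(d,ℓ') ∣ n]` with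
`W = (Re α_ℓ Re α_ℓ' + Im α_ℓ Im α_ℓ') φ(d)/√(ℓℓ')`. [folklore] -/
theorem re_gcdForm_eq_sum_classes (α : ℕ → ℂ) (L n : ℕ) :
    (∑ ℓ ∈ Finset.Icc 1 L, ∑ ℓ' ∈ Finset.Icc 1 L, α ℓ * (starRingEnd ℂ) (α ℓ') *
        (((Nat.gcd (n * ℓ') ℓ : ℕ) : ℝ) : ℂ) / (Real.sqrt ((ℓ : ℝ) * ℓ') : ℂ)).re =
      ∑ ℓ ∈ Finset.Icc 1 L, ∑ ℓ' ∈ Finset.Icc 1 L, ∑ d ∈ ℓ.divisors,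
        ((α ℓ).re * (α ℓ').re + (α ℓ).im * (α ℓ').im) * (Nat.totient d : ℝ) / Real.sqrt ((ℓ : ℝ) * ℓ') *
          (if d / Nat.gcd d ℓ' ∣ n then 1 else 0) := by
  simp only [Complex.re_sum, re_term]
  refine Finset.sum_congr rfl fun ℓ hℓ => Finset.sum_congr rfl fun ℓ' _ => ?_
  have hℓ0 : ℓ ≠ 0 := by
    have := (Finset.mem_Icc.1 hℓ).1
    omega
  rw [natCast_gcd_mul_eq_sum_totient n ℓ ℓ' hℓ0, Finset.mul_sum, Finset.sum_div]
  refine Finset.sum_congr rfl fun d _ => ?_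
  split_ifs <;> ring

/-- **Convergence of the type partial sums (every design) from Mertens + Loc.**  For `c ≥ 0` with Mertens
`Σ_{n ≤ x} c(n)/n − log x → C` and Loc `Σ_{p ∣ n} c(n)/n < ∞` (all primes `p`), the partial sums
`Σ_{n ≤ x} ((c(n) − Λ(n))/n) Re Φ_α(n)` converge for every `α : ℕ → ℂ` and every `L`; the limit is
`Σ_{ℓ,ℓ' ≤ L} Σ_{d ∣ ℓ} W(ℓ,ℓ',d) S_{d/gcd(d,ℓ')}` with the class limits `S_e` of `tendsto_classSum`. [folklore] -/
theorem tendsto_typeSum (c : ℕ → ℝ) (hc0 : ∀ n, 0 ≤ c n)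
    (hM : ∃ C : ℝ, Tendsto (fun x : ℝ => (∑ n ∈ Finset.Icc 1 ⌊x⌋₊, c n / n) - Real.log x) atTop (𝓝 C))
    (hLoc : ∀ p : ℕ, p.Prime → Summable (fun n : ℕ => if p ∣ n then c n / n else 0))
    (α : ℕ → ℂ) (L : ℕ) :
    ∃ T : ℝ, Tendsto (fun x : ℝ => ∑ n ∈ Finset.Icc 1 ⌊x⌋₊,
        (c n - ArithmeticFunction.vonMangoldt n) / n *
          (∑ ℓ ∈ Finset.Icc 1 L, ∑ ℓ' ∈ Finset.Icc 1 L, α ℓ * (starRingEnd ℂ) (α ℓ') *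
          (((Nat.gcd (n * ℓ') ℓ : ℕ) : ℝ) : ℂ) / (Real.sqrt ((ℓ : ℝ) * ℓ') : ℂ)).re) atTop (𝓝 T) := by
  classical
  -- class limits
  have hcl : ∀ e : ℕ, ∃ S : ℝ, e ≠ 0 → Tendsto (fun x : ℝ => ∑ n ∈ Finset.Icc 1 ⌊x⌋₊,
      (if e ∣ n then (c n - ArithmeticFunction.vonMangoldt n) / n else 0)) atTop (𝓝 S) := by
    intro e
    by_cases he : e = 0
    · exact ⟨0, fun h => (h he).elim⟩
    · obtain ⟨S, hS⟩ := tendsto_classSum c hc0 hM hLoc e he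
      exact ⟨S, fun _ => hS⟩
  choose S hS using hcl
  set W : ℕ → ℕ → ℕ → ℝ := fun ℓ ℓ' d =>
    ((α ℓ).re * (α ℓ').re + (α ℓ).im * (α ℓ').im) * (Nat.totient d : ℝ) / Real.sqrt ((ℓ : ℝ) * ℓ') with hW
  refine ⟨∑ ℓ ∈ Finset.Icc 1 L, ∑ ℓ' ∈ Finset.Icc 1 L, ∑ d ∈ ℓ.divisors, W ℓ ℓ' d * S (d / Nat.gcd d ℓ'), ?_⟩
  have hlim : Tendsto (fun x : ℝ => ∑ ℓ ∈ Finset.Icc 1 L, ∑ ℓ' ∈ Finset.Icc 1 L, ∑ d ∈ ℓ.divisors,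
      W ℓ ℓ' d * ∑ n ∈ Finset.Icc 1 ⌊x⌋₊,
        (if d / Nat.gcd d ℓ' ∣ n then (c n - ArithmeticFunction.vonMangoldt n) / n else 0)) atTop
      (𝓝 (∑ ℓ ∈ Finset.Icc 1 L, ∑ ℓ' ∈ Finset.Icc 1 L, ∑ d ∈ ℓ.divisors, W ℓ ℓ' d * S (d / Nat.gcd d ℓ'))) := by
    refine tendsto_finsetSum _ fun ℓ hℓ => tendsto_finsetSum _ fun ℓ' _ => tendsto_finsetSum _ fun d hd => ?_
    refine (hS _ ?_).const_mul _
    have hd0 : 0 < d := Nat.pos_of_mem_divisors hd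
    exact Nat.ne_of_gt (Nat.div_pos (Nat.le_of_dvd hd0 (Nat.gcd_dvd_left _ _)) (Nat.gcd_pos_of_pos_left _ hd0))
  refine hlim.congr fun x => ?_
  -- pointwise: exchange the order of summation
  symm
  calc ∑ n ∈ Finset.Icc 1 ⌊x⌋₊, (c n - ArithmeticFunction.vonMangoldt n) / n *
          (∑ ℓ ∈ Finset.Icc 1 L, ∑ ℓ' ∈ Finset.Icc 1 L, α ℓ * (starRingEnd ℂ) (α ℓ') *
          (((Nat.gcd (n * ℓ') ℓ : ℕ) : ℝ) : ℂ) / (Real.sqrt ((ℓ : ℝ) * ℓ') : ℂ)).re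
        = ∑ n ∈ Finset.Icc 1 ⌊x⌋₊, ∑ ℓ ∈ Finset.Icc 1 L, ∑ ℓ' ∈ Finset.Icc 1 L, ∑ d ∈ ℓ.divisors,
            W ℓ ℓ' d * (if d / Nat.gcd d ℓ' ∣ n then (c n - ArithmeticFunction.vonMangoldt n) / n else 0) := by
          refine Finset.sum_congr rfl fun n _ => ?_
          rw [re_gcdForm_eq_sum_classes, Finset.mul_sum]
          refine Finset.sum_congr rfl fun ℓ _ => ?_
          rw [Finset.mul_sum]
          refine Finset.sum_congr rfl fun ℓ' _ => ?_
          rw [Finset.mul_sum]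
          refine Finset.sum_congr rfl fun d _ => ?_
          simp only [hW]
          split_ifs <;> ring
    _ = ∑ ℓ ∈ Finset.Icc 1 L, ∑ ℓ' ∈ Finset.Icc 1 L, ∑ d ∈ ℓ.divisors, W ℓ ℓ' d *
          ∑ n ∈ Finset.Icc 1 ⌊x⌋₊,
            (if d / Nat.gcd d ℓ' ∣ n then (c n - ArithmeticFunction.vonMangoldt n) / n else 0) := by
          rw [Finset.sum_comm]
          refine Finset.sum_congr rfl fun ℓ _ => ?_
          rw [Finset.sum_comm]
          refine Finset.sum_congr rfl fun ℓ' _ => ?_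
          rw [Finset.sum_comm]
          refine Finset.sum_congr rfl fun d _ => ?_
          rw [Finset.mul_sum]

/-- **Given convergence, the type inequality is a bound on THE limit.**  If the type partial sums of `α` tend to
`T`, the type-inequality clause for `α` holds iff `T ≤ ½ Re Φ_α(1)`. [folklore] -/
theorem typeIneq_iff_limit_le (c : ℕ → ℝ) (α : ℕ → ℂ) (L : ℕ) (T : ℝ)
    (hT : Tendsto (fun x : ℝ => ∑ n ∈ Finset.Icc 1 ⌊x⌋₊,
        (c n - ArithmeticFunction.vonMangoldt n) / n *
          (∑ ℓ ∈ Finset.Icc 1 L, ∑ ℓ' ∈ Finset.Icc 1 L, α ℓ * (starRingEnd ℂ) (α ℓ') *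
          (((Nat.gcd (n * ℓ') ℓ : ℕ) : ℝ) : ℂ) / (Real.sqrt ((ℓ : ℝ) * ℓ') : ℂ)).re) atTop (𝓝 T)) :
    (∃ T' : ℝ, Tendsto (fun x : ℝ => ∑ n ∈ Finset.Icc 1 ⌊x⌋₊,
        (c n - ArithmeticFunction.vonMangoldt n) / n *
          (∑ ℓ ∈ Finset.Icc 1 L, ∑ ℓ' ∈ Finset.Icc 1 L, α ℓ * (starRingEnd ℂ) (α ℓ') *
          (((Nat.gcd (n * ℓ') ℓ : ℕ) : ℝ) : ℂ) / (Real.sqrt ((ℓ : ℝ) * ℓ') : ℂ)).re) atTop (𝓝 T') ∧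
        T' ≤ 1 / 2 * (∑ ℓ ∈ Finset.Icc 1 L, ∑ ℓ' ∈ Finset.Icc 1 L, α ℓ * (starRingEnd ℂ) (α ℓ') *
          (((Nat.gcd (1 * ℓ') ℓ : ℕ) : ℝ) : ℂ) / (Real.sqrt ((ℓ : ℝ) * ℓ') : ℂ)).re) ↔
      T ≤ 1 / 2 * (∑ ℓ ∈ Finset.Icc 1 L, ∑ ℓ' ∈ Finset.Icc 1 L, α ℓ * (starRingEnd ℂ) (α ℓ') *
          (((Nat.gcd (1 * ℓ') ℓ : ℕ) : ℝ) : ℂ) / (Real.sqrt ((ℓ : ℝ) * ℓ') : ℂ)).re := by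
  constructor
  · rintro ⟨T', hT', hle⟩
    rwa [tendsto_nhds_unique hT hT']
  · intro hle
    exact ⟨T, hT, hle⟩

/-- **Summary for the lead**: with Mertens and Loc in hand, the type inequalities for all finitely supported
complex designs follow from the BOUND `T(β) ≤ ½ Re Φ_β(1)` on the (automatically existing) limits for finitely
supported REAL designs `β`. [folklore] -/
theorem typeIneq_of_real_limit_bound (c : ℕ → ℝ) (hc0 : ∀ n, 0 ≤ c n)
    (hM : ∃ C : ℝ, Tendsto (fun x : ℝ => (∑ n ∈ Finset.Icc 1 ⌊x⌋₊, c n / n) - Real.log x) atTop (𝓝 C))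
    (hLoc : ∀ p : ℕ, p.Prime → Summable (fun n : ℕ => if p ∣ n then c n / n else 0))
    (hbound : ∀ β : ℕ → ℝ, ∀ L : ℕ, (∀ m, L < m → β m = 0) → ∀ T : ℝ,
      Tendsto (fun x : ℝ => ∑ n ∈ Finset.Icc 1 ⌊x⌋₊,
          (c n - ArithmeticFunction.vonMangoldt n) / n *
            (∑ ℓ ∈ Finset.Icc 1 L, ∑ ℓ' ∈ Finset.Icc 1 L, ((β ℓ : ℝ) : ℂ) * (starRingEnd ℂ) ((β ℓ' : ℝ) : ℂ) *
            (((Nat.gcd (n * ℓ') ℓ : ℕ) : ℝ) : ℂ) / (Real.sqrt ((ℓ : ℝ) * ℓ') : ℂ)).re) atTop (𝓝 T) →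
        T ≤ 1 / 2 * (∑ ℓ ∈ Finset.Icc 1 L, ∑ ℓ' ∈ Finset.Icc 1 L, ((β ℓ : ℝ) : ℂ) * (starRingEnd ℂ) ((β ℓ' : ℝ) : ℂ) *
            (((Nat.gcd (1 * ℓ') ℓ : ℕ) : ℝ) : ℂ) / (Real.sqrt ((ℓ : ℝ) * ℓ') : ℂ)).re) :
    ∀ α : ℕ → ℂ, ∀ L : ℕ, (∀ m, L < m → α m = 0) →
      ∃ T : ℝ, Tendsto (fun x : ℝ => ∑ n ∈ Finset.Icc 1 ⌊x⌋₊,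
          (c n - ArithmeticFunction.vonMangoldt n) / n *
            (∑ ℓ ∈ Finset.Icc 1 L, ∑ ℓ' ∈ Finset.Icc 1 L, α ℓ * (starRingEnd ℂ) (α ℓ') *
            (((Nat.gcd (n * ℓ') ℓ : ℕ) : ℝ) : ℂ) / (Real.sqrt ((ℓ : ℝ) * ℓ') : ℂ)).re) atTop (𝓝 T) ∧
        T ≤ 1 / 2 * (∑ ℓ ∈ Finset.Icc 1 L, ∑ ℓ' ∈ Finset.Icc 1 L, α ℓ * (starRingEnd ℂ) (α ℓ') *
            (((Nat.gcd (1 * ℓ') ℓ : ℕ) : ℝ) : ℂ) / (Real.sqrt ((ℓ : ℝ) * ℓ') : ℂ)).re := by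
  refine typeIneq_of_real c fun β L hβ => ?_
  obtain ⟨T, hT⟩ := tendsto_typeSum c hc0 hM hLoc (fun m => ((β m : ℝ) : ℂ)) L
  exact ⟨T, hT, hbound β L hβ T hT⟩

/-! ### 5. Registered anchors (explicit signatures) -/

/-- **Anchor `typeRealReduction`** (registered sub-goal): type inequalities for finitely supported real designs
imply them for all finitely supported complex designs. [folklore] -/
theorem typeRealReduction : ∀ c : ℕ → ℝ,
    (∀ β : ℕ → ℝ, ∀ L : ℕ, (∀ m, L < m → β m = 0) →
      ∃ T : ℝ, Filter.Tendsto (fun x : ℝ => ∑ n ∈ Finset.Icc 1 ⌊x⌋₊,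
          (c n - ArithmeticFunction.vonMangoldt n) / n *
            (∑ ℓ ∈ Finset.Icc 1 L, ∑ ℓ' ∈ Finset.Icc 1 L, ((β ℓ : ℝ) : ℂ) * (starRingEnd ℂ) ((β ℓ' : ℝ) : ℂ) *
            (((Nat.gcd (n * ℓ') ℓ : ℕ) : ℝ) : ℂ) / (Real.sqrt ((ℓ : ℝ) * ℓ') : ℂ)).re) Filter.atTop (nhds T) ∧
        T ≤ 1 / 2 * (∑ ℓ ∈ Finset.Icc 1 L, ∑ ℓ' ∈ Finset.Icc 1 L, ((β ℓ : ℝ) : ℂ) * (starRingEnd ℂ) ((β ℓ' : ℝ) : ℂ) *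
            (((Nat.gcd (1 * ℓ') ℓ : ℕ) : ℝ) : ℂ) / (Real.sqrt ((ℓ : ℝ) * ℓ') : ℂ)).re) →
    ∀ α : ℕ → ℂ, ∀ L : ℕ, (∀ m, L < m → α m = 0) →
      ∃ T : ℝ, Filter.Tendsto (fun x : ℝ => ∑ n ∈ Finset.Icc 1 ⌊x⌋₊,
          (c n - ArithmeticFunction.vonMangoldt n) / n *
            (∑ ℓ ∈ Finset.Icc 1 L, ∑ ℓ' ∈ Finset.Icc 1 L, α ℓ * (starRingEnd ℂ) (α ℓ') *
            (((Nat.gcd (n * ℓ') ℓ : ℕ) : ℝ) : ℂ) / (Real.sqrt ((ℓ : ℝ) * ℓ') : ℂ)).re) Filter.atTop (nhds T) ∧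
        T ≤ 1 / 2 * (∑ ℓ ∈ Finset.Icc 1 L, ∑ ℓ' ∈ Finset.Icc 1 L, α ℓ * (starRingEnd ℂ) (α ℓ') *
            (((Nat.gcd (1 * ℓ') ℓ : ℕ) : ℝ) : ℂ) / (Real.sqrt ((ℓ : ℝ) * ℓ') : ℂ)).re :=
  typeIneq_of_real

/-- **Anchor `typeConvergence`** (registered sub-goal): Mertens for `c` + Loc ⟹ the type partial sums converge
for every design. [folklore] -/
theorem typeConvergence : ∀ c : ℕ → ℝ, (∀ n, 0 ≤ c n) →
    (∃ C : ℝ, Filter.Tendsto (fun x : ℝ => (∑ n ∈ Finset.Icc 1 ⌊x⌋₊, c n / n) - Real.log x)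
      Filter.atTop (nhds C)) →
    (∀ p : ℕ, p.Prime → Summable (fun n : ℕ => if p ∣ n then c n / n else 0)) →
    ∀ α : ℕ → ℂ, ∀ L : ℕ,
      ∃ T : ℝ, Filter.Tendsto (fun x : ℝ => ∑ n ∈ Finset.Icc 1 ⌊x⌋₊,
          (c n - ArithmeticFunction.vonMangoldt n) / n *
            (∑ ℓ ∈ Finset.Icc 1 L, ∑ ℓ' ∈ Finset.Icc 1 L, α ℓ * (starRingEnd ℂ) (α ℓ') *
            (((Nat.gcd (n * ℓ') ℓ : ℕ) : ℝ) : ℂ) / (Real.sqrt ((ℓ : ℝ) * ℓ') : ℂ)).re) Filter.atTop (nhds T) :=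
  tendsto_typeSum

/-- **Anchor `typeOfRealLimitBound`** (registered sub-goal): Mertens + Loc + the bound `T ≤ ½ Re Φ_β(1)` on the
limits for finitely supported real designs ⟹ the type inequalities for all finitely supported complex designs
(the conclusion of `stub_combType`, verbatim). [folklore] -/
theorem typeOfRealLimitBound : ∀ c : ℕ → ℝ, (∀ n, 0 ≤ c n) →
    (∃ C : ℝ, Filter.Tendsto (fun x : ℝ => (∑ n ∈ Finset.Icc 1 ⌊x⌋₊, c n / n) - Real.log x)
      Filter.atTop (nhds C)) →
    (∀ p : ℕ, p.Prime → Summable (fun n : ℕ => if p ∣ n then c n / n else 0)) →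
    (∀ β : ℕ → ℝ, ∀ L : ℕ, (∀ m, L < m → β m = 0) → ∀ T : ℝ,
      Filter.Tendsto (fun x : ℝ => ∑ n ∈ Finset.Icc 1 ⌊x⌋₊,
          (c n - ArithmeticFunction.vonMangoldt n) / n *
            (∑ ℓ ∈ Finset.Icc 1 L, ∑ ℓ' ∈ Finset.Icc 1 L, ((β ℓ : ℝ) : ℂ) * (starRingEnd ℂ) ((β ℓ' : ℝ) : ℂ) *
            (((Nat.gcd (n * ℓ') ℓ : ℕ) : ℝ) : ℂ) / (Real.sqrt ((ℓ : ℝ) * ℓ') : ℂ)).re) Filter.atTop (nhds T) →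
        T ≤ 1 / 2 * (∑ ℓ ∈ Finset.Icc 1 L, ∑ ℓ' ∈ Finset.Icc 1 L, ((β ℓ : ℝ) : ℂ) * (starRingEnd ℂ) ((β ℓ' : ℝ) : ℂ) *
            (((Nat.gcd (1 * ℓ') ℓ : ℕ) : ℝ) : ℂ) / (Real.sqrt ((ℓ : ℝ) * ℓ') : ℂ)).re) →
    ∀ α : ℕ → ℂ, ∀ L : ℕ, (∀ m, L < m → α m = 0) →
      ∃ T : ℝ, Filter.Tendsto (fun x : ℝ => ∑ n ∈ Finset.Icc 1 ⌊x⌋₊,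
          (c n - ArithmeticFunction.vonMangoldt n) / n *
            (∑ ℓ ∈ Finset.Icc 1 L, ∑ ℓ' ∈ Finset.Icc 1 L, α ℓ * (starRingEnd ℂ) (α ℓ') *
            (((Nat.gcd (n * ℓ') ℓ : ℕ) : ℝ) : ℂ) / (Real.sqrt ((ℓ : ℝ) * ℓ') : ℂ)).re) Filter.atTop (nhds T) ∧
        T ≤ 1 / 2 * (∑ ℓ ∈ Finset.Icc 1 L, ∑ ℓ' ∈ Finset.Icc 1 L, α ℓ * (starRingEnd ℂ) (α ℓ') *
            (((Nat.gcd (1 * ℓ') ℓ : ℕ) : ℝ) : ℂ) / (Real.sqrt ((ℓ : ℝ) * ℓ') : ℂ)).re :=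
  typeIneq_of_real_limit_bound

end TypeIneq

end Summit.RiemannHypothesis.RiemannHypothesis.Theorems.SignConeConeMagnification

end
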